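import Summits.PneNP.PneNP.Theorems.SmallBlockRothvossBallGridCells
import Summits.PneNP.PneNP.Theorems.SmallBlockRothvossBallGrid
import Summits.PneNP.PneNP.Theorems.SmallBlockRothvossAccounting
import Literature.Barriers.PneNP.TSPExtensionComplexityRothvossKernel
import Literature.Combinatorics.Optimization.PsdFactorizationRescaling
import Literature.Combinatorics.Optimization.EquivariantPsdStructure
import HarnessLib

/-!
# Block psd lifts of the perfect matching polytope (cell pnp-psdrank, rung F-N2.SOC): the net and the core inequality

Landing file 2 of 4 (pnp-psdrank-eng g4; work file HOME/pnp-psdrank-eng/lean/BlockLift.lean v2, sha256/16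
01d03dbb37281499, Parts B–C). `netBall_dominated`: for weights `W ≤ K` (`K ≥ 0`, all rectangle sums `≤ θ₀`)
and vectors `a_x, c_y ∈ ℝ^b` of norm `≤ 1`, at any grid resolution `L` with `b ≤ L²`:
`Σ W⟪a,c⟫² ≤ (2L+1)^{2b} θ₀ + η Σ K⟪a,c⟫² + τ ΣK` for `τ ≥ 112 b/(η²L²)`. `core_at`: at Rothvoß's slot sizes,
every `r`-term `(S^b_+)` factorization of the `t`-cut slack matrix of `P_PM(n)` satisfies, for every such `L`,
`1/2 ≤ b⁴ Δ r ((2L+1)^{2b}·2θ_R(m) + 448 b Δ²/L²)` (`Δ = t − 1`) — Rothvoß's all-rectangle weight datum with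
dominating kernel (`exists_WK_fin`), the weak Briët–Dadush–Pokutta rescaling (`rescale_weak`), the square-root
split (`trace_mul_eq_sum_sq_sqrtRow`) and the abstract accounting of the `2 × 2` chain (`abstract_accounting`).
The point of this normalisation: `Δ` enters once (through `η = 1/(2Δ)`), never inside a `b`-th power, so the
resulting block bound is polynomial in `b` (file `SmallBlockRothvossBallGridBound`).
WHAT THIS IS NOT: no statement about general psd rank (rung F-N2 stays open), nothing P ≠ NP-relevant.
-/

set_option linter.dupNamespace false -- `Summit.PneNP.PneNP.…`: summit = sub-problem (D-0017)

noncomputable section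

open scoped Classical MatrixOrder

open Finset Real Matrix Literature.Barriers.PneNP Literature.Combinatorics.Optimization
  Literature.Combinatorics.Optimization.EquivariantPsdStructure

namespace Summit.PneNP.PneNP.Theorems.SmallBlockRothvossBallGrid

variable {b : ℕ}

/-- **The cube-grid net (all-rectangle form).** For weights `W ≤ K`, `K ≥ 0`, all rectangle sums of `W`
at most `θ₀ ≥ 0`, vectors `a_x, c_y ∈ ℝ^b` of norm `≤ 1`, `0 < η ≤ 1`, and a grid resolution `L` with
`b ≤ L²`: `Σ W⟪a,c⟫² ≤ (2L+1)^{2b} θ₀ + η Σ K⟪a,c⟫² + τ ΣK` for every `τ ≥ 112 b/(η² L²)`. -/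
theorem netBall_dominated {α β : Type*} [Fintype α] [Fintype β] (W K : α → β → ℝ) (θ₀ η τ : ℝ)
    (L : ℕ) (a : α → Fin b → ℝ) (c : β → Fin b → ℝ) (hK0 : ∀ x y, 0 ≤ K x y)
    (hWK : ∀ x y, W x y ≤ K x y) (hθ : 0 ≤ θ₀) (hη : 0 < η) (hη1 : η ≤ 1) (hL : 0 < L)
    (hbL : b ≤ L ^ 2) (ha : ∀ x, a x ⬝ᵥ a x ≤ 1) (hc : ∀ y, c y ⬝ᵥ c y ≤ 1)
    (hrect : ∀ (X : Finset α) (Y : Finset β), ∑ x ∈ X, ∑ y ∈ Y, W x y ≤ θ₀)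
    (hτ : 112 * b / (η ^ 2 * (L : ℝ) ^ 2) ≤ τ) :
    ∑ x, ∑ y, W x y * (a x ⬝ᵥ c y) ^ 2 ≤
      ((2 * L + 1 : ℝ) ^ b) ^ 2 * θ₀ + η * ∑ x, ∑ y, K x y * (a x ⬝ᵥ c y) ^ 2 +
        τ * ∑ x, ∑ y, K x y := by
  classical
  have hL' : (0 : ℝ) < L := by exact_mod_cast hL
  set esq : ℝ := 7 * b / (4 * (L : ℝ) ^ 2) with hesq
  have hesq0 : 0 ≤ esq := by positivity
  set e : ℝ := Real.sqrt esq with he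
  have he0 : 0 ≤ e := Real.sqrt_nonneg _
  have hee : e ^ 2 = esq := Real.sq_sqrt hesq0
  -- the cell data
  set κ : (Fin b → ℤ) → (Fin b → ℤ) → ℝ := fun i j => |ctr L i ⬝ᵥ ctr L j| with hκ
  have hdist : ∀ x y, |a x ⬝ᵥ c y - ctr L (cell L (a x)) ⬝ᵥ ctr L (cell L (c y))| ≤ e := by
    intro x y
    rw [← Real.sqrt_sq_eq_abs, he]
    exact Real.sqrt_le_sqrt (distortion_sq_le hL hbL (ha x) (hc y))
  have hlo : ∀ x y, κ (cell L (a x)) (cell L (c y)) - e ≤ |a x ⬝ᵥ c y| := by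
    intro x y
    have h1 := hdist x y
    have h2 := abs_sub_abs_le_abs_sub (ctr L (cell L (a x)) ⬝ᵥ ctr L (cell L (c y))) (a x ⬝ᵥ c y)
    rw [abs_sub_comm] at h2
    simp only [hκ]
    linarith
  have hhi : ∀ x y, |a x ⬝ᵥ c y| ≤ κ (cell L (a x)) (cell L (c y)) + e := by
    intro x y
    have h1 := hdist x y
    have h2 := abs_add_le (ctr L (cell L (a x)) ⬝ᵥ ctr L (cell L (c y)))
      (a x ⬝ᵥ c y - ctr L (cell L (a x)) ⬝ᵥ ctr L (cell L (c y)))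
    rw [add_sub_cancel] at h2
    simp only [hκ]
    linarith
  have hd1 : ∀ x y, (a x ⬝ᵥ c y) ^ 2 ≤ 1 := by
    intro x y
    have h1 := dotProduct_sq_le_mul (ha x) (hc y)
    linarith
  have hτ' : ((6 / η + 2) * e) ^ 2 ≤ τ := by
    refine le_trans ?_ hτ
    have h1 : ((6 / η + 2) * e) ^ 2 = (6 / η + 2) ^ 2 * esq := by rw [mul_pow, hee]
    rw [h1]
    have h2 : (6 / η + 2) ^ 2 ≤ (8 / η) ^ 2 := by
      have h3 : 6 / η + 2 ≤ 8 / η := by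
        rw [div_add' _ _ _ hη.ne', div_le_div_iff_of_pos_right hη]; linarith
      exact pow_le_pow_left₀ (by positivity) h3 2
    calc (6 / η + 2) ^ 2 * esq ≤ (8 / η) ^ 2 * esq := mul_le_mul_of_nonneg_right h2 hesq0
      _ = 112 * b / (η ^ 2 * (L : ℝ) ^ 2) := by rw [hesq]; field_simp; ring
  have key := cells_bound W K (fun x y => a x ⬝ᵥ c y) (fun x => cell L (a x)) (fun y => cell L (c y))
    (box b L) (box b L) κ e η τ θ₀ (fun x => cell_mem_box (ha x)) (fun y => cell_mem_box (hc y))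
    hWK hK0 hη hη1 he0 hθ hrect (fun i j => abs_nonneg _) hlo hhi hd1 hτ'
  rw [card_box] at key
  simpa only [sq] using key


set_option maxHeartbeats 400000 in
/-- **The block bound at grid resolution `L`.** For `m = 2μ+1` large and `n = |Slot m 72|`: if the `t`-cut
slack matrix `|δ(U) ∩ M| − 1` of `P_PM(n)` (`t = tCut 72 μ`, `Δ = t − 1`) is a sum of `r` pairings of psd
`b × b` blocks, then for every grid resolution `L ≥ 1` with `b ≤ L²`:
`1/2 ≤ b⁴ Δ r ((2L+1)^{2b}·2θ_R(m) + 448 b Δ²/L²)`. -/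
theorem core_at (μ : ℕ) {m : ℕ} (hm : m = 2 * μ + 1)
    (hU1 : (64 / cU εR) ^ 2 ≤ (m : ℝ) + 1) (hU2 : 32 / cU εR ≤ (m : ℝ) + 1)
    (hM1 : 16 * FQ * Real.log QB / cM qR εR ≤ (m : ℝ)) {b r : ℕ}
    (A : {U : Finset (Fin (Fintype.card (Slot m qR))) // U.card = tCut qR μ} →
      Fin r → Matrix (Fin b) (Fin b) ℝ)
    (B : {M : Finset (Sym2 (Fin (Fintype.card (Slot m qR)))) // IsPMOn univ M} →
      Fin r → Matrix (Fin b) (Fin b) ℝ)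
    (hA : ∀ a i, (A a i).PosSemidef) (hB : ∀ b i, (B b i).PosSemidef)
    (hfac : ∀ (a : {U : Finset (Fin (Fintype.card (Slot m qR))) // U.card = tCut qR μ})
      (c : {M : Finset (Sym2 (Fin (Fintype.card (Slot m qR)))) // IsPMOn univ M}),
      ((c.1.filter (fun f => cutCount a.1 f = 1)).card : ℝ) - 1 = ∑ i, (A a i * B c i).trace)
    (L : ℕ) (hL : 0 < L) (hbL : b ≤ L ^ 2) :
    (1 : ℝ) / 2 ≤ (b : ℝ) ^ 4 * ((tCut qR μ : ℝ) - 1) * r *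
      (((2 * L + 1 : ℝ) ^ b) ^ 2 * (2 * θR m) +
        448 * b * ((tCut qR μ : ℝ) - 1) ^ 2 / (L : ℝ) ^ 2) := by
  -- the weight datum
  obtain ⟨W, K, hrect, hsum, hWK, hK0, hKsum⟩ := exists_WK_fin μ hm hU1 hU2 hM1
  -- parameters
  have ht3 : 3 ≤ tCut qR μ := by unfold tCut; omega
  have hΔ2 : (2 : ℝ) ≤ (tCut qR μ : ℝ) - 1 := by
    have : (3 : ℝ) ≤ (tCut qR μ : ℝ) := by exact_mod_cast ht3
    linarith
  generalize hΔ : ((tCut qR μ : ℝ) - 1) = Δ at hΔ2 ⊢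
  have hΔ0 : 0 < Δ := by linarith
  have hθ0 : 0 < θR m := θR_pos m
  generalize hθ : θR m = θ at hrect hθ0 ⊢
  have hL' : (0 : ℝ) < L := by exact_mod_cast hL
  set η : ℝ := 1 / (2 * Δ) with hηdef
  have hη : 0 < η := by rw [hηdef]; positivity
  have hη1 : η ≤ 1 := by
    rw [hηdef, div_le_one (by positivity)]; linarith
  have hηΔ : η * Δ = 1 / 2 := by rw [hηdef]; field_simp
  set τ : ℝ := 112 * b / (η ^ 2 * (L : ℝ) ^ 2) with hτdef
  have hτ0 : 0 ≤ τ := by rw [hτdef]; positivity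
  have hτeq : τ = 448 * b * Δ ^ 2 / (L : ℝ) ^ 2 := by
    rw [hτdef, hηdef]; field_simp; ring
  -- slack
  have hSΔ : ∀ (a : {U : Finset (Fin (Fintype.card (Slot m qR))) // U.card = tCut qR μ})
      (c : {M : Finset (Sym2 (Fin (Fintype.card (Slot m qR)))) // IsPMOn univ M}),
      ((c.1.filter (fun f => cutCount a.1 f = 1)).card : ℝ) - 1 ≤ Δ := by
    intro a c
    have h1 := c.2.card_cut_le (subset_univ a.1)
    rw [a.2] at h1
    have h2 : (((c.1.filter (fun f => cutCount a.1 f = 1)).card : ℕ) : ℝ) ≤ (tCut qR μ : ℝ) := by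
      exact_mod_cast h1
    rw [← hΔ]
    linarith
  -- blocks
  set T : Fin r → {U : Finset (Fin (Fintype.card (Slot m qR))) // U.card = tCut qR μ} →
      {M : Finset (Sym2 (Fin (Fintype.card (Slot m qR)))) // IsPMOn univ M} → ℝ :=
    fun i a c => (A a i * B c i).trace with hTdef
  have hST : ∀ a c, ((c.1.filter (fun f => cutCount a.1 f = 1)).card : ℝ) - 1 = ∑ i, T i a c :=
    fun a c => hfac a c
  have hTfac : ∀ i, HasPsdFactorization (T i) b := fun i =>
    ⟨fun a => A a i, fun c => B c i, fun a => hA a i, fun c => hB c i, fun a c => rfl⟩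
  have hT0 : ∀ i a c, 0 ≤ T i a c := fun i a c => (hTfac i).entry_nonneg a c
  have hTΔ : ∀ i a c, T i a c ≤ Δ := by
    intro i a c
    have h1 : T i a c ≤ ∑ j, T j a c :=
      single_le_sum (f := fun j => T j a c) (fun j _ => hT0 j a c) (mem_univ i)
    linarith [hST a c, hSΔ a c]
  have hresc : ∀ i, ∃ (X : {U : Finset (Fin (Fintype.card (Slot m qR))) // U.card = tCut qR μ} →
        Matrix (Fin b) (Fin b) ℝ)
      (Y : {M : Finset (Sym2 (Fin (Fintype.card (Slot m qR)))) // IsPMOn univ M} →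
        Matrix (Fin b) (Fin b) ℝ),
      (∀ a, (X a).PosSemidef ∧ (1 - X a).PosSemidef) ∧ (∀ c, (Y c).PosSemidef ∧ (1 - Y c).PosSemidef) ∧
      ∀ a c, T i a c = ((b : ℕ) : ℝ) ^ 2 * Δ * (X a * Y c).trace :=
    fun i => (hTfac i).rescale_weak hΔ0 (hTΔ i)
  choose X Y hX hY hTXY using hresc
  -- the rank-one-vector pieces
  set G : (Fin r × (Fin b × Fin b)) →
      {U : Finset (Fin (Fintype.card (Slot m qR))) // U.card = tCut qR μ} →
      {M : Finset (Sym2 (Fin (Fintype.card (Slot m qR)))) // IsPMOn univ M} → ℝ :=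
    fun ipq a c => (sqrtRow (X ipq.1 a) ipq.2.1 ⬝ᵥ sqrtRow (Y ipq.1 c) ipq.2.2) ^ 2 with hGdef
  have hS : ∀ (a : {U : Finset (Fin (Fintype.card (Slot m qR))) // U.card = tCut qR μ})
      (c : {M : Finset (Sym2 (Fin (Fintype.card (Slot m qR)))) // IsPMOn univ M}),
      ((c.1.filter (fun f => cutCount a.1 f = 1)).card : ℝ) - 1 =
        ((b : ℝ) ^ 2 * Δ) * ∑ ipq, G ipq a c := by
    intro a c
    rw [hST a c, Fintype.sum_prod_type (f := fun ipq : Fin r × (Fin b × Fin b) => G ipq a c),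
      mul_sum]
    refine sum_congr rfl fun i _ => ?_
    rw [hTXY i a c, trace_mul_eq_sum_sq_sqrtRow (hX i a).1 (hY i c).1,
      Fintype.sum_prod_type (f := fun pq : Fin b × Fin b => G (i, pq) a c)]
  -- per-piece net
  set E : ℝ := ((2 * L + 1 : ℝ) ^ b) ^ 2 * (2 * θ) with hEdef
  have hpiece : ∀ ipq, ∑ a, ∑ c, W a c * G ipq a c ≤
      E + η * ∑ a, ∑ c, K a c * G ipq a c + τ * ∑ a, ∑ c, K a c := by
    intro ipq
    exact netBall_dominated W K (2 * θ) η τ L (fun a => sqrtRow (X ipq.1 a) ipq.2.1)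
      (fun c => sqrtRow (Y ipq.1 c) ipq.2.2) hK0 hWK (by positivity) hη hη1 hL hbL
      (fun a => sqrtRow_sq_le_one (hX ipq.1 a).1 (hX ipq.1 a).2 _)
      (fun c => sqrtRow_sq_le_one (hY ipq.1 c).1 (hY ipq.1 c).2 _) hrect le_rfl
  -- `⟨K, S⟩ ≤ Δ`
  have hKS : ∑ a, ∑ c, K a c * (((c.1.filter (fun f => cutCount a.1 f = 1)).card : ℝ) - 1) ≤ Δ := by
    calc ∑ a, ∑ c, K a c * (((c.1.filter (fun f => cutCount a.1 f = 1)).card : ℝ) - 1)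
        ≤ ∑ a, ∑ c, K a c * Δ :=
          sum_le_sum fun a _ => sum_le_sum fun c _ => mul_le_mul_of_nonneg_left (hSΔ a c) (hK0 a c)
      _ = (∑ a, ∑ c, K a c) * Δ := by rw [sum_mul]; simp_rw [sum_mul]
      _ ≤ 1 * Δ := mul_le_mul_of_nonneg_right hKsum hΔ0.le
      _ = Δ := one_mul Δ
  have hc0 : (0 : ℝ) ≤ (b : ℝ) ^ 2 * Δ := mul_nonneg (sq_nonneg _) hΔ0.le
  have key := SmallBlockRothvoss.abstract_accounting W K
    (fun a c => ((c.1.filter (fun f => cutCount a.1 f = 1)).card : ℝ) - 1) G ((b : ℝ) ^ 2 * Δ) E η τ Δ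
    hc0 hη.le hsum hS hpiece hKS
  -- arithmetic
  have hcard : (Fintype.card (Fin r × (Fin b × Fin b)) : ℝ) = r * (b : ℝ) ^ 2 := by
    simp only [Fintype.card_prod, Fintype.card_fin]; push_cast; ring
  rw [hcard, hηΔ] at key
  have hKτ : τ * ∑ a, ∑ c, K a c ≤ τ := by
    calc τ * ∑ a, ∑ c, K a c ≤ τ * 1 := mul_le_mul_of_nonneg_left hKsum hτ0
      _ = τ := mul_one τ
  have hr0 : (0 : ℝ) ≤ r := Nat.cast_nonneg r
  have hpre : (0 : ℝ) ≤ (b : ℝ) ^ 2 * Δ * (r * (b : ℝ) ^ 2) :=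
    mul_nonneg hc0 (mul_nonneg hr0 (sq_nonneg _))
  have h1 : (b : ℝ) ^ 2 * Δ * (r * (b : ℝ) ^ 2 * (E + τ * ∑ a, ∑ c, K a c)) ≤
      (b : ℝ) ^ 2 * Δ * (r * (b : ℝ) ^ 2) * (E + τ) := by
    have := mul_le_mul_of_nonneg_left (show E + τ * ∑ a, ∑ c, K a c ≤ E + τ by linarith) hpre
    linarith [this]
  have hmain : (1 : ℝ) / 2 ≤ (b : ℝ) ^ 2 * Δ * (r * (b : ℝ) ^ 2) * (E + τ) := by linarith
  rw [hEdef, hτeq] at hmain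
  have hfin : (b : ℝ) ^ 2 * Δ * (r * (b : ℝ) ^ 2) *
      (((2 * L + 1 : ℝ) ^ b) ^ 2 * (2 * θ) + 448 * b * Δ ^ 2 / (L : ℝ) ^ 2) =
      (b : ℝ) ^ 4 * Δ * r * (((2 * L + 1 : ℝ) ^ b) ^ 2 * (2 * θ) + 448 * b * Δ ^ 2 / (L : ℝ) ^ 2) := by
    ring
  linarith [hfin]

end Summit.PneNP.PneNP.Theorems.SmallBlockRothvossBallGrid

end
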